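import Literature.MathematicalPhysics.QuantumFieldTheory.Balaban1983to89.B12Lemma4Uses
import Literature.MathematicalPhysics.QuantumFieldTheory.Balaban1983to89.B12NearTerms321

/-!
# `Balaban1983to89.B12Remainder354Localized` — T. Bałaban, *Renormalization group approach to lattice gauge field theories. I*,
Commun. Math. Phys. **109** (1987) 249–301 [Balaban1987RG1], p. 280 [PDF 32], the LOCALIZATION CAVEAT after (3.54):

*«Because |B| < O(1)L^jη, e.g. |B| < α₁L^jη, hence we have the required bound. In fact we have to be more careful, because this bound
holds on □̃⁴ only. We should localize the inner product in domains □̃⁴, (□̃⁴)ᶜ, and if at least one factor has a localization in (□̃⁴)ᶜ,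
then the expression can be estimated by an arbitrary power of L^jη using the exponential decay properties. The considerations are similar
to those done on several occasions, e.g. (3.6), (3.21), and we do not repeat them.»*  — and (v1.1, §5) the FINAL REMARK closing §3:
*«Let us make a final remark about the constant in the inequality (3.54). It is much bigger than E₀, and further bounds and summations
will make it worse. Eventually we have to recover the constant E₀ in the inductive assumption (1.18), and the mechanism for it is
provided by the differentiation with respect to t_□, at t_□ = 0. This differentiation yields a factor O(1)α₂⁻¹ε₁, and taking ε₁
sufficiently small we can get the required constant.»*

HONEST FRAMING (cell `lit-balaban`, verbatim): statement-level skeleton of published theorems with citation tags; proofs where landed; nothing here is a claim about the Yang–Mills mass gap.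

PDF held: `paper:balaban1987-cmp109-rg-i-small-field` (journal page = PDF page + 248); p. 280 re-read on the render
`run/shared/lean/pub/pub-balaban/b2b-balaban-ref1/pages/1987-cmp109-rg-I-small-field/…-p032-x2.png`; pp. 277 (3.35), 281–282 (4.1)/(4.5).

CONTEXT.  The last term of the fundamental expansion (3.34) is `∫₀¹ dτ ((1−τ)⁴/4!) ⟨δ⁵f/δB⁵(τB), ⊗⁵B⟩`, `f(B) = 𝐄^{(j)}(X, U_j(□₀, exp iB))`;
(3.54) bounds it by `E₀α₃⁻⁵|B|⁵exp(−κd_j(X))` (unit r20: `B12CauchyRemainder354.ineq354`, `remainder334_norm_le`; on the concrete frame of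
Lemma 4: `B12Lemma4Uses.ineq354_frameOf`).  The caveat: the size `|B| < α₁L^jη` ((3.32)) holds on `□̃⁴` only, so one splits every
argument `B = χB + (1−χ)B` (`χ` = the localization to `□̃⁴`; this is (4.1) p. 281 at `n = 5`), keeps the Cauchy estimate for the term with
all five arguments inside, and bounds every term with at least one argument in `(□̃⁴)ᶜ` by the exponential decay of the derivatives of
`𝐄^{(j)}` in a localized argument ((4.5)-type, [15] Sect. G: the factor `exp(−δ₀ dist(X, (□̃⁴)ᶜ))` with `dist ≥ M(L^jη)⁻¹` for `X ⊂ □̃²`),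
which is «an arbitrary power of L^jη» (`exp(−c·x⁻¹) ≤ N!c^{−N}xᴺ`, the device of (3.6)/(3.21): `B12.exp_neg_inv_le_pow`,
`B12NearTerms321.smallFactor321`).

WHAT THIS MODULE PROVES (theorems only; 0 sorry, 0 definitions, 0 new `Prop`-facts; axioms standard), in r20's carrier-free style
(`E` a real normed space of fields, `F` a normed space of values — complex and complete in §2 —, `f : E → F`) plus a concrete-frame corollary:
* §1 `iteratedFDeriv_split_norm_le` — the multilinear localization: for ANY decomposition `B = a + c` of the arguments,
  `‖⟨D⁵f(x), ⊗⁵B⟩‖ ≤ ‖⟨D⁵f(x), ⊗⁵a⟩‖ + Σ_{s ≠ univ} ‖⟨D⁵f(x), (a on s, c off s)⟩‖` — the `2⁵ − 1 = 31` mixed localization patterns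
  (`MultilinearMap.map_add_univ`; no symmetry or analyticity needed), and `iteratedFDeriv_split_norm_le_of_bounds` (with uniform bounds
  `Cin`, `Cout`: `≤ Cin + 31·Cout`);
* §2 `norm_iteratedFDeriv_dir_le_of_slice` — the INSIDE term by Cauchy: if the slice `t ↦ f(x + t·a)` agrees near `t = 0` with a function
  holomorphic on the disc `|σ| < r` and bounded by `M` there (Lemma 4 with `B′ = σ·χB`, `r = α₃/|χB|`, and (1.18)), then
  `‖⟨D⁵f(x), ⊗⁵a⟩‖ ≤ 5!·M/r⁵` (translation `iteratedFDeriv_comp_add_left` + r20's ray/`ofReal` lemmas + `norm_iteratedDeriv_le_of_ball`);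
* §3 `remainder334_localized_norm_le` — the caveat assembled: `‖∫₀¹ dτ ((1−τ)⁴/4!) ⟨δ⁵f/δB⁵(τB), ⊗⁵B⟩‖ ≤ (Cin + 31·Cout)/5!` from pointwise
  bounds of the two kinds; `remainder334_localized_printed` — with `Cin = 5!·M·(|a|/α₃)⁵` and the OUTSIDE terms of (4.5)-shape
  `Cout = K·exp(−(δ₀/2)·D)`, `M₀·x⁻¹ ≤ D` (`x = L^jη`): `≤ M α₃⁻⁵|a|⁵ + (31/5!)·K·(N!/(δ₀M₀/2)ᴺ)·xᴺ` for every `N` («an arbitrary power of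
  L^jη»); `remainder334_localized_335` — with `|a| ≤ α₁x` (the (3.32) size ON □̃⁴), `M = E₀e^{−κd}`, `K = K′e^{−κd}`, `N ≥ 5`, `x ≤ 1`:
  `≤ (E₀α₃⁻⁵α₁⁵ + (31/5!)K′N!/(δ₀M₀/2)ᴺ)·e^{−κd}·x⁵` — the bound «of the form (3.35)»;
* §4 `norm_iteratedFDeriv_dir_le_frameOf` — on the concrete frame of Lemma 4 (`B12Lemma4ConcreteFrame.frameOf D`) the hypotheses of §2 for
  the inside term are DISCHARGED by `B12Lemma4Uses.differentiableOn_E_slice` / `norm_E_slice_le` (Lemma 4 + the p. 263 hypotheses on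
  `𝐄^{(j)}`), the slice being tied to the frame by the coherence «`f(τB + t·a)` is `𝐄^{(j)}` at the Lemma-4 pair `(V, J(V))(𝐔, 𝐀, τ, t·W)`»;
* §5 (v1.1) `deriv_tbox_le_factor` — the final remark's MECHANISM: the term as a function `Φ` of `t_□` (through `B̃_□` (3.22) and (3.25)),
  analytic on `|t_□| < R` and bounded by the (3.54)-constant `C` on the Cauchy circle `|t_□| = r` of (3.15) (`r·m = α₂/3`, `m ≤ 2s`; r20's
  `B12CauchyRemainder354.ineq317_printed`), with the `t_□`-direction field of size `s ≤ K·ε₁`: `‖(d/dt_□)Φ(0)‖ ≤ C·(6Kα₂⁻¹)·ε₁` («yields a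
  factor O(1)α₂⁻¹ε₁»); `deriv_tbox_le_of_eps_small` — with `C = C₀·X` (`C₀` «much bigger than E₀», `X` the shape factor of (3.35)) and
  `ε₁ ≤ E₀α₂/(6KC₀)`: `‖(d/dt_□)Φ(0)‖ ≤ E₀·X` («taking ε₁ sufficiently small we can get the required constant» `E₀` of (1.18)).
HONEST SCOPE.  The OUTSIDE-term bound (hypothesis `hout`, the (4.5)-type tree decay of [15] Sect. G for a derivative with an argument
localized in `(□̃⁴)ᶜ`; cell GAPS G-B11-G2a) and the size `|χB| ≤ α₁L^jη` ((3.32)) are inputs in printed shape, exactly as the caveat invokes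
them («using the exponential decay properties»); the geometric fact `dist(X, (□̃⁴)ᶜ) ≥ M(L^jη)⁻¹` enters as `hD`.  Nothing of (3.6)/(3.21) is
re-proved (rows `B12.Eq3.6-3.8`, `B12.Def@274`).  In §5 the analyticity of the term in `t_□` and the size `s ≤ Kε₁` of the `t_□`-direction
field `ζ_□𝐇_k(B′)` ((3.9)/(3.31)-type) are inputs; «further bounds and summations» are not modelled (the factor is exhibited for one term).  Unit `lit-balaban-p07` (Phase-2 seat p07 gen 9; free-target protocol G.5-34(d); TAKING
line HOME/STATUS.md 2026-08-21T20:46:07Z; rows B12.Eq3.54 / B12.Eq3.35, owners r09/r20, referee ref-5), HOME `run/shared/lean/pub/lit-balaban/`.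
-/

noncomputable section

open NormedSpace Complex Set Metric Filter
open scoped Topology Nat BigOperators

namespace Literature.MathematicalPhysics.QuantumFieldTheory.Balaban1983to89.B12Remainder354Localized

open Literature.MathematicalPhysics.QuantumFieldTheory.Balaban1983to89
open Literature.MathematicalPhysics.QuantumFieldTheory.Balaban1983to89.B12CauchyRemainder354
  (norm_iteratedDeriv_le_of_ball iteratedDeriv_comp_ofReal)
open Literature.MathematicalPhysics.QuantumFieldTheory.Balaban1983to89.B12NearTerms321 (smallFactor321)

/-! ## §1. The multilinear localization of `⟨D⁵f(x), ⊗⁵B⟩` over the `2⁵` patterns ((4.1) at `n = 5`, without symmetry) -/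

section Split

variable {E F : Type*} [NormedAddCommGroup E] [NormedSpace ℝ E] [NormedAddCommGroup F] [NormedSpace ℝ F]

/-- **The localization split** («We should localize the inner product in domains □̃⁴, (□̃⁴)ᶜ»): for any decomposition `B = a + c` of the
five arguments (`a = χB` inside, `c = (1−χ)B` outside), by multilinearity `⟨D⁵f(x), ⊗⁵B⟩ = Σ_s ⟨D⁵f(x), (a on s, c off s)⟩` over the `2⁵`
subsets `s` of the five slots; the term `s = univ` is the all-inside one, the `31` others have «at least one factor [with] a localization
in (□̃⁴)ᶜ»: `‖⟨D⁵f(x), ⊗⁵B⟩‖ ≤ ‖⟨D⁵f(x), ⊗⁵a⟩‖ + Σ_{s ≠ univ} ‖⟨D⁵f(x), (a on s, c off s)⟩‖`.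
[cite: Balaban1987RG1, p.280 after (3.54); (4.1) p.281] -/
theorem iteratedFDeriv_split_norm_le (f : E → F) (x a c : E) {n : ℕ} :
    ‖iteratedFDeriv ℝ n f x (fun _ => a + c)‖ ≤ ‖iteratedFDeriv ℝ n f x (fun _ => a)‖ +
      ∑ s ∈ (Finset.univ : Finset (Finset (Fin n))).erase Finset.univ,
        ‖iteratedFDeriv ℝ n f x (s.piecewise (fun _ => a) (fun _ => c))‖ := by
  classical
  have hsplit : iteratedFDeriv ℝ n f x ((fun _ => a) + fun _ => c) =
      ∑ s : Finset (Fin n), iteratedFDeriv ℝ n f x (s.piecewise (fun _ => a) (fun _ => c)) := by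
    have h := (iteratedFDeriv ℝ n f x).toMultilinearMap.map_add_univ (fun _ : Fin n => a) (fun _ => c)
    simpa only [ContinuousMultilinearMap.coe_coe] using h
  have hfun : (fun _ : Fin n => a + c) = ((fun _ => a) + fun _ => c) := rfl
  rw [hfun, hsplit, ← Finset.add_sum_erase _ _ (Finset.mem_univ (Finset.univ : Finset (Fin n))),
    Finset.piecewise_univ]
  exact (norm_add_le _ _).trans (add_le_add le_rfl (norm_sum_le _ _))

/-- The number of mixed localization patterns of `n` slots: `2ⁿ − 1`. [cite: Balaban1987RG1, p.280 after (3.54)] -/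
theorem card_mixed_patterns (n : ℕ) :
    ((Finset.univ : Finset (Finset (Fin n))).erase Finset.univ).card = 2 ^ n - 1 := by
  rw [Finset.card_erase_of_mem (Finset.mem_univ _), Finset.card_univ, Fintype.card_finset, Fintype.card_fin]

/-- **The split with uniform bounds**: if the all-inside term is `≤ Cin` and every mixed term `≤ Cout`, then
`‖⟨D⁵f(x), ⊗⁵B⟩‖ ≤ Cin + (2⁵ − 1)·Cout = Cin + 31·Cout`. [cite: Balaban1987RG1, p.280 after (3.54)] -/
theorem iteratedFDeriv_split_norm_le_of_bounds (f : E → F) (x a c : E) {Cin Cout : ℝ}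
    (hin : ‖iteratedFDeriv ℝ 5 f x (fun _ => a)‖ ≤ Cin)
    (hout : ∀ s : Finset (Fin 5), s ≠ Finset.univ →
      ‖iteratedFDeriv ℝ 5 f x (s.piecewise (fun _ => a) (fun _ => c))‖ ≤ Cout) :
    ‖iteratedFDeriv ℝ 5 f x (fun _ => a + c)‖ ≤ Cin + 31 * Cout := by
  classical
  refine (iteratedFDeriv_split_norm_le f x a c).trans (add_le_add hin ?_)
  have hsum : ∑ s ∈ (Finset.univ : Finset (Finset (Fin 5))).erase Finset.univ,
      ‖iteratedFDeriv ℝ 5 f x (s.piecewise (fun _ => a) (fun _ => c))‖ ≤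
      ((Finset.univ : Finset (Finset (Fin 5))).erase Finset.univ).card • Cout :=
    Finset.sum_le_card_nsmul _ _ _ fun s hs => hout s (Finset.ne_of_mem_erase hs)
  have hcard : ((Finset.univ : Finset (Finset (Fin 5))).erase Finset.univ).card = 31 := by
    rw [card_mixed_patterns]; norm_num
  rw [hcard, nsmul_eq_mul] at hsum
  simpa only [Nat.cast_ofNat] using hsum

end Split

/-! ## §2. The inside term: Cauchy's estimate along the slice `τB + σ·χB` (Lemma 4 with `B′ = σχB`, radius `α₃/|χB|`) -/

section Slice

variable {E F : Type*} [NormedAddCommGroup E] [NormedSpace ℝ E] [NormedAddCommGroup F] [NormedSpace ℂ F] [CompleteSpace F]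

omit [CompleteSpace F] in
/-- The directional fifth derivative as a derivative along the slice: for `f` of class `C⁵` on an open set `s ∋ x`,
`⟨D⁵f(x), ⊗⁵a⟩ = (d/dt)⁵|_{t=0} f(x + t·a)` (translation `iteratedFDeriv_comp_add_left` + the ray lemma of `B12Taylor334`).
[cite: Balaban1987RG1, (3.54) p.280] -/
theorem iteratedFDeriv_dir_eq_iteratedDeriv_slice {s : Set E} (hs : IsOpen s) {f : E → F} (hf : ContDiffOn ℝ 5 f s)
    {x : E} (hx : x ∈ s) (a : E) :
    iteratedFDeriv ℝ 5 f x (fun _ => a) = iteratedDeriv 5 (fun t : ℝ => f (x + t • a)) 0 := by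
  -- the translated function `f_x(z) = f(x + z)` is `C⁵` on the translated open set
  have hs' : IsOpen ((fun z : E => x + z) ⁻¹' s) := hs.preimage (continuous_const.add continuous_id)
  have hf' : ContDiffOn ℝ 5 (fun z : E => f (x + z)) ((fun z : E => x + z) ⁻¹' s) :=
    hf.comp (contDiff_const.add contDiff_id).contDiffOn fun z hz => hz
  have h0 : (0 : ℝ) • a ∈ (fun z : E => x + z) ⁻¹' s := by simpa using hx
  have hray := B12Taylor334.iteratedDeriv_comp_ray hs' hf' a h0 (le_refl 5)
  simp only [zero_smul, iteratedFDeriv_comp_add_left, add_zero] at hray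
  exact hray.symm

/-- **The inside term by Cauchy** («this bound holds on □̃⁴»: all five arguments localized in `□̃⁴`): if the slice `t ↦ f(x + t·a)` agrees
near `t = 0` with a function `Ψ` holomorphic on the disc `|σ| < r` and bounded there by `M` — the paper: `x = τB`, `a = χB`, Lemma 4 with
`B′ = σχB`, `|σ| < r = α₃/|χB|`, and (1.18), `M = E₀exp(−κd_j(X))` — then `‖⟨D⁵f(x), ⊗⁵a⟩‖ ≤ 5!·M/r⁵`.
[cite: Balaban1987RG1, (3.54) p.280] -/
theorem norm_iteratedFDeriv_dir_le_of_slice {s : Set E} (hs : IsOpen s) {f : E → F} (hf : ContDiffOn ℝ 5 f s)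
    {x : E} (hx : x ∈ s) (a : E) {Ψ : ℂ → F} {r M : ℝ} (hr : 0 < r) (hΨ : DifferentiableOn ℂ Ψ (ball (0 : ℂ) r))
    (hM : ∀ σ ∈ ball (0 : ℂ) r, ‖Ψ σ‖ ≤ M) (hagree : ∀ᶠ t : ℝ in 𝓝 0, f (x + t • a) = Ψ (t : ℂ)) :
    ‖iteratedFDeriv ℝ 5 f x (fun _ => a)‖ ≤ 5 ! * M / r ^ 5 := by
  rw [iteratedFDeriv_dir_eq_iteratedDeriv_slice hs hf hx a, Filter.EventuallyEq.iteratedDeriv_eq 5 hagree]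
  have h0 : ((0 : ℝ) : ℂ) ∈ ball (0 : ℂ) r := by simpa using hr
  rw [iteratedDeriv_comp_ofReal isOpen_ball 5 hΨ h0, Complex.ofReal_zero]
  exact norm_iteratedDeriv_le_of_ball hr hΨ hM 5

end Slice

/-! ## §3. The caveat assembled: the last term of (3.34) after localization -/

section Assembled

variable {E F : Type*} [NormedAddCommGroup E] [NormedSpace ℝ E] [NormedAddCommGroup F] [NormedSpace ℝ F]

/-- `∫₀¹ (1 − τ)⁴/4! dτ = 1/5!`. [folklore] -/
private theorem integral_weight : ∫ τ in (0 : ℝ)..1, (1 - τ) ^ 4 / (4 ! : ℝ) = 1 / (5 ! : ℝ) := by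
  have hint : ∫ τ in (0 : ℝ)..1, (1 - τ) ^ 4 = 1 / 5 := by
    have h := intervalIntegral.integral_comp_sub_left (a := (0 : ℝ)) (b := 1) (fun x : ℝ => x ^ 4) (1 : ℝ)
    simp only [sub_self, sub_zero] at h
    rw [h, integral_pow]
    norm_num
  rw [intervalIntegral.integral_div, hint]
  norm_num [Nat.factorial]

/-- **The localization caveat, assembled** (p. 280): if along the segment `τ ∈ [0, 1]` the all-inside term obeys
`‖⟨D⁵f(τB), ⊗⁵a⟩‖ ≤ Cin` and every mixed term `‖⟨D⁵f(τB), (a on s, c off s)⟩‖ ≤ Cout` (`B = a + c`), then the last term of (3.34) satisfies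
`‖∫₀¹ dτ ((1−τ)⁴/4!) ⟨δ⁵f/δB⁵(τB), ⊗⁵B⟩‖ ≤ (Cin + 31·Cout)/5!`. [cite: Balaban1987RG1, p.280 after (3.54); (3.34) p.277] -/
theorem remainder334_localized_norm_le (f : E → F) {B a c : E} (hsum : a + c = B) {Cin Cout : ℝ}
    (hin : ∀ τ ∈ Icc (0 : ℝ) 1, ‖iteratedFDeriv ℝ 5 f (τ • B) (fun _ => a)‖ ≤ Cin)
    (hout : ∀ τ ∈ Icc (0 : ℝ) 1, ∀ s : Finset (Fin 5), s ≠ Finset.univ →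
      ‖iteratedFDeriv ℝ 5 f (τ • B) (s.piecewise (fun _ => a) (fun _ => c))‖ ≤ Cout) :
    ‖∫ τ in (0 : ℝ)..1, ((1 - τ) ^ 4 / (4 ! : ℝ)) • iteratedFDeriv ℝ 5 f (τ • B) (fun _ => B)‖
      ≤ (Cin + 31 * Cout) / (5 ! : ℝ) := by
  have hpt : ∀ τ ∈ Icc (0 : ℝ) 1, ‖iteratedFDeriv ℝ 5 f (τ • B) (fun _ => B)‖ ≤ Cin + 31 * Cout := by
    intro τ hτ
    rw [← hsum]
    exact iteratedFDeriv_split_norm_le_of_bounds f (τ • (a + c)) a c (hsum ▸ hin τ hτ) (hsum ▸ hout τ hτ)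
  have hle : ‖∫ τ in (0 : ℝ)..1, ((1 - τ) ^ 4 / (4 ! : ℝ)) • iteratedFDeriv ℝ 5 f (τ • B) (fun _ => B)‖
      ≤ ∫ τ in (0 : ℝ)..1, (1 - τ) ^ 4 / (4 ! : ℝ) * (Cin + 31 * Cout) := by
    refine intervalIntegral.norm_integral_le_of_norm_le zero_le_one ?_ ?_
    · refine Filter.Eventually.of_forall fun τ hτ => ?_
      have hτ' : τ ∈ Icc (0 : ℝ) 1 := Ioc_subset_Icc_self hτ
      have hw : 0 ≤ (1 - τ) ^ 4 / (4 ! : ℝ) := by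
        have : 0 ≤ 1 - τ := by linarith [hτ'.2]
        positivity
      rw [norm_smul, Real.norm_of_nonneg hw]
      exact mul_le_mul_of_nonneg_left (hpt τ hτ') hw
    · exact (by fun_prop : Continuous fun τ : ℝ => (1 - τ) ^ 4 / (4 ! : ℝ) * (Cin + 31 * Cout)).intervalIntegrable _ _
  refine hle.trans (le_of_eq ?_)
  rw [intervalIntegral.integral_mul_const, integral_weight]
  ring

/-- **With the printed inputs** («… then the expression can be estimated by an arbitrary power of L^jη using the exponential decay
properties»): the inside term by the Cauchy estimate `Cin = 5!·M·(|a|/α₃)⁵` (§2, radius `α₃/|a|`), the mixed terms by a bound of (4.5)-shape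
`Cout = K·exp(−(δ₀/2)·D)` with the decay length dominating `M₀·x⁻¹` (`x = L^jη`, `dist(X, (□̃⁴)ᶜ) ≥ M(L^jη)⁻¹` for `X ⊂ □̃²`): then for every `N`,
`‖last term of (3.34)‖ ≤ M·α₃⁻⁵·|a|⁵ + (31/5!)·K·(N!/(δ₀M₀/2)ᴺ)·xᴺ`. [cite: Balaban1987RG1, p.280 after (3.54); (4.5) p.282; (3.21) p.274] -/
theorem remainder334_localized_printed (f : E → F) {B a c : E} (hsum : a + c = B) {M α₃ na K δ₀ M₀ Dd x : ℝ}
    (hα₃ : 0 < α₃) (hK : 0 ≤ K) (hδ₀ : 0 < δ₀) (hM₀ : 0 < M₀) (hx : 0 < x) (hD : M₀ * x⁻¹ ≤ Dd)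
    (hin : ∀ τ ∈ Icc (0 : ℝ) 1, ‖iteratedFDeriv ℝ 5 f (τ • B) (fun _ => a)‖ ≤ 5 ! * M / (α₃ / na) ^ 5)
    (hout : ∀ τ ∈ Icc (0 : ℝ) 1, ∀ s : Finset (Fin 5), s ≠ Finset.univ →
      ‖iteratedFDeriv ℝ 5 f (τ • B) (s.piecewise (fun _ => a) (fun _ => c))‖ ≤ K * Real.exp (-(δ₀ / 2) * Dd)) (N : ℕ) :
    ‖∫ τ in (0 : ℝ)..1, ((1 - τ) ^ 4 / (4 ! : ℝ)) • iteratedFDeriv ℝ 5 f (τ • B) (fun _ => B)‖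
      ≤ M * α₃⁻¹ ^ 5 * na ^ 5 + 31 / (5 ! : ℝ) * (K * ((N ! : ℝ) / (δ₀ / 2 * M₀) ^ N) * x ^ N) := by
  -- the mixed-term constant is «an arbitrary power of L^jη»
  have hsmall : K * Real.exp (-(δ₀ / 2) * Dd) ≤ K * ((N ! : ℝ) / (δ₀ / 2 * M₀) ^ N) * x ^ N := by
    have h := smallFactor321 (T := K * Real.exp (-(δ₀ / 2) * Dd)) hK hδ₀ hM₀ hx (le_of_eq (abs_of_nonneg (by positivity)))
      hD N
    rwa [abs_of_nonneg (by positivity)] at h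
  have h := remainder334_localized_norm_le f hsum hin (fun τ hτ s hs => (hout τ hτ s hs).trans hsmall)
  refine h.trans (le_of_eq ?_)
  have h5 : ((5 ! : ℕ) : ℝ) ≠ 0 := by positivity
  field_simp

/-- **The bound «of the form (3.35)» after localization**: with the (3.32) size of the INSIDE part `|a| = |χB| ≤ α₁·x` (`x = L^jη ≤ 1`), the
(1.18) sup `M = E₀exp(−κd)` and mixed-term constant `K = K′exp(−κd)`, and a power `N ≥ 5`:
`‖last term of (3.34)‖ ≤ (E₀α₃⁻⁵α₁⁵ + (31/5!)·K′·N!/(δ₀M₀/2)ᴺ)·exp(−κd)·x⁵` — `O(1)·exp(−κd_j(X))·(O(1)L^jη)⁵`.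
[cite: Balaban1987RG1, (3.35) p.277; p.280 after (3.54)] -/
theorem remainder334_localized_335 (f : E → F) {B a c : E} (hsum : a + c = B) {E₀ κ d α₃ α₁ na K' δ₀ M₀ Dd x : ℝ}
    (hE₀ : 0 ≤ E₀) (hα₃ : 0 < α₃) (hna : 0 ≤ na) (hK' : 0 ≤ K') (hδ₀ : 0 < δ₀) (hM₀ : 0 < M₀)
    (hx : 0 < x) (hx1 : x ≤ 1) (hD : M₀ * x⁻¹ ≤ Dd) (hax : na ≤ α₁ * x)
    (hin : ∀ τ ∈ Icc (0 : ℝ) 1, ‖iteratedFDeriv ℝ 5 f (τ • B) (fun _ => a)‖ ≤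
      5 ! * (E₀ * Real.exp (-(κ * d))) / (α₃ / na) ^ 5)
    (hout : ∀ τ ∈ Icc (0 : ℝ) 1, ∀ s : Finset (Fin 5), s ≠ Finset.univ →
      ‖iteratedFDeriv ℝ 5 f (τ • B) (s.piecewise (fun _ => a) (fun _ => c))‖ ≤
        K' * Real.exp (-(κ * d)) * Real.exp (-(δ₀ / 2) * Dd))
    {N : ℕ} (hN : 5 ≤ N) :
    ‖∫ τ in (0 : ℝ)..1, ((1 - τ) ^ 4 / (4 ! : ℝ)) • iteratedFDeriv ℝ 5 f (τ • B) (fun _ => B)‖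
      ≤ (E₀ * α₃⁻¹ ^ 5 * α₁ ^ 5 + 31 / (5 ! : ℝ) * (K' * ((N ! : ℝ) / (δ₀ / 2 * M₀) ^ N))) *
        Real.exp (-(κ * d)) * x ^ 5 := by
  have hK : 0 ≤ K' * Real.exp (-(κ * d)) := by positivity
  have h := remainder334_localized_printed f hsum hα₃ hK hδ₀ hM₀ hx hD hin hout N
  refine h.trans ?_
  -- first term: |a|⁵ ≤ α₁⁵x⁵; second term: xᴺ ≤ x⁵
  have h1 : E₀ * Real.exp (-(κ * d)) * α₃⁻¹ ^ 5 * na ^ 5 ≤ E₀ * α₃⁻¹ ^ 5 * α₁ ^ 5 * Real.exp (-(κ * d)) * x ^ 5 := by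
    have hpow : na ^ 5 ≤ (α₁ * x) ^ 5 := pow_le_pow_left₀ hna hax 5
    have hc : 0 ≤ E₀ * Real.exp (-(κ * d)) * α₃⁻¹ ^ 5 := by positivity
    calc E₀ * Real.exp (-(κ * d)) * α₃⁻¹ ^ 5 * na ^ 5 ≤ E₀ * Real.exp (-(κ * d)) * α₃⁻¹ ^ 5 * (α₁ * x) ^ 5 :=
          mul_le_mul_of_nonneg_left hpow hc
      _ = E₀ * α₃⁻¹ ^ 5 * α₁ ^ 5 * Real.exp (-(κ * d)) * x ^ 5 := by ring
  have h2 : 31 / (5 ! : ℝ) * (K' * Real.exp (-(κ * d)) * ((N ! : ℝ) / (δ₀ / 2 * M₀) ^ N) * x ^ N) ≤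
      31 / (5 ! : ℝ) * (K' * ((N ! : ℝ) / (δ₀ / 2 * M₀) ^ N)) * Real.exp (-(κ * d)) * x ^ 5 := by
    have hxN : x ^ N ≤ x ^ 5 := pow_le_pow_of_le_one hx.le hx1 hN
    have hc : 0 ≤ 31 / (5 ! : ℝ) * (K' * Real.exp (-(κ * d)) * ((N ! : ℝ) / (δ₀ / 2 * M₀) ^ N)) := by positivity
    calc 31 / (5 ! : ℝ) * (K' * Real.exp (-(κ * d)) * ((N ! : ℝ) / (δ₀ / 2 * M₀) ^ N) * x ^ N)
        = 31 / (5 ! : ℝ) * (K' * Real.exp (-(κ * d)) * ((N ! : ℝ) / (δ₀ / 2 * M₀) ^ N)) * x ^ N := by ring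
      _ ≤ 31 / (5 ! : ℝ) * (K' * Real.exp (-(κ * d)) * ((N ! : ℝ) / (δ₀ / 2 * M₀) ^ N)) * x ^ 5 :=
          mul_le_mul_of_nonneg_left hxN hc
      _ = 31 / (5 ! : ℝ) * (K' * ((N ! : ℝ) / (δ₀ / 2 * M₀) ^ N)) * Real.exp (-(κ * d)) * x ^ 5 := by ring
  calc E₀ * Real.exp (-(κ * d)) * α₃⁻¹ ^ 5 * na ^ 5 +
        31 / (5 ! : ℝ) * (K' * Real.exp (-(κ * d)) * ((N ! : ℝ) / (δ₀ / 2 * M₀) ^ N) * x ^ N)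
      ≤ E₀ * α₃⁻¹ ^ 5 * α₁ ^ 5 * Real.exp (-(κ * d)) * x ^ 5 +
        31 / (5 ! : ℝ) * (K' * ((N ! : ℝ) / (δ₀ / 2 * M₀) ^ N)) * Real.exp (-(κ * d)) * x ^ 5 := add_le_add h1 h2
    _ = (E₀ * α₃⁻¹ ^ 5 * α₁ ^ 5 + 31 / (5 ! : ℝ) * (K' * ((N ! : ℝ) / (δ₀ / 2 * M₀) ^ N))) *
        Real.exp (-(κ * d)) * x ^ 5 := by ring

end Assembled

/-! ## §4. On the concrete frame of Lemma 4: the inside-term hypotheses discharged by `B12Lemma4Uses` §2 -/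

section Frame

open Literature.MathematicalPhysics.QuantumFieldTheory.Balaban1983to89.B12RegularSpaces111
open Literature.MathematicalPhysics.QuantumFieldTheory.Balaban1983to89.B12Eq18Current
open Literature.MathematicalPhysics.QuantumFieldTheory.Balaban1983to89.B12Lemma4ConcreteFrame
open Literature.MathematicalPhysics.QuantumFieldTheory.Balaban1983to89.B12Lemma4Uses

variable {P : Params} {i : ℕ} {𝔸 : Type} [NormedRing 𝔸] [NormedAlgebra ℂ 𝔸] [CompleteSpace 𝔸]
variable {𝓜 : Model 𝔸} {c : B12Sec2to5.Lemma4Consts}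
variable {V : Type*} [NormedAddCommGroup V] [NormedSpace ℂ V] [CompleteSpace V]

/-- **The inside term on the concrete frame**: for `f` (the paper's `B ↦ 𝐄^{(j)}(X, U_j(□₀, exp iB))` on the real field space `PBond → 𝔸`)
of class `C⁵` near the point `x = τB` whose slice in the direction `a = χB` IS `𝐄^{(j)}` at the Lemma-4 pair `(V, J(V))(𝐔, 𝐀, τ, t·W)`
(coherence `hcoh`, the identification of the frame's `B′`-slot with `t·χB`; `W` the field playing `χB`), with `|σW| ≤ |σ|·nW` in the
frame's size and `𝐄^{(j)}(X, ·)` analytic on `U^c_j(X, α₀, α₁)` and bounded there by `M`: `‖⟨D⁵f(x), ⊗⁵a⟩‖ ≤ 5!·M·(nW/α₃)⁵` — the §2 hypotheses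
supplied by Lemma 4 (`B12Lemma4Uses.differentiableOn_E_slice`, `norm_E_slice_le`). [cite: Balaban1987RG1, (3.54) p.280; Lemma 4 p.280] -/
theorem norm_iteratedFDeriv_dir_le_frameOf [NormOneClass 𝔸] (D : Lemma4Data P i 𝓜 c) (hR : B12Sec2to5.Lemma4Restrictions c)
    (E : (PBond P i → 𝔸) × (PBond P i → 𝔸) → V)
    (hE : ∀ Ψ ∈ space' 𝓜 D.F D.cs c.α₀ c.α₁, AnalyticAt ℂ E ((fun b => (Ψ.U b : 𝔸)), Ψ.J))
    {M : ℝ} (hM : ∀ Ψ ∈ space' 𝓜 D.F D.cs c.α₀ c.α₁, ‖E ((fun b => (Ψ.U b : 𝔸)), Ψ.J)‖ ≤ M)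
    {Φ : FieldPair P i 𝔸ˣ 𝔸} {A W : PBond P i → 𝔸} {τ : ℝ}
    (hΦ : Φ ∈ space 𝓜 D.F' D.cs' ((1 + 2 * c.β) * c.α₀) ((1 + 2 * c.β) * c.α₁) D.γ₀') (hA : A ∈ D.A331)
    (hτ0 : 0 ≤ τ) (hτ1 : τ ≤ 1) {nW : ℝ} (hnW : 0 < nW) (hhom : ∀ σ : ℂ, D.normB (σ • W) ≤ ‖σ‖ * nW)
    {s : Set (PBond P i → 𝔸)} (hs : IsOpen s) {f : (PBond P i → 𝔸) → V} (hf : ContDiffOn ℝ 5 f s)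
    {x a : PBond P i → 𝔸} (hx : x ∈ s)
    (hcoh : ∀ᶠ t : ℝ in 𝓝 0, f (x + t • a) = E
      ((fun b => ((ofBackground D.π D.cs.ξ
          (fun b => expI D.cs.ξ (D.K Φ A τ b + D.A₂ Φ A τ (((t : ℂ)) • W) b))).U b : 𝔸)),
        (ofBackground D.π D.cs.ξ (fun b => expI D.cs.ξ (D.K Φ A τ b + D.A₂ Φ A τ (((t : ℂ)) • W) b))).J)) :
    ‖iteratedFDeriv ℝ 5 f x (fun _ => a)‖ ≤ 5 ! * M / (c.α₃ / nW) ^ 5 := by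
  have hα₃ : 0 < c.α₃ := hR.2.2.2.1
  have hr : 0 < c.α₃ / nW := div_pos hα₃ hnW
  have hdom : ∀ σ ∈ ball (0 : ℂ) (c.α₃ / nW), D.normB ((0 : PBond P i → 𝔸) + σ • W) < c.α₃ := by
    intro σ hσ
    rw [mem_ball_zero_iff] at hσ
    rw [zero_add]
    calc D.normB (σ • W) ≤ ‖σ‖ * nW := hhom σ
      _ < c.α₃ / nW * nW := by gcongr
      _ = c.α₃ := div_mul_cancel₀ _ hnW.ne'
  have hΨ := differentiableOn_E_slice D hR E hE hΦ hA hτ0 hτ1 hdom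
  have hMΨ := norm_E_slice_le D hR E hM hΦ hA hτ0 hτ1 hdom
  simp only [zero_add] at hΨ hMΨ
  exact norm_iteratedFDeriv_dir_le_of_slice hs hf hx a hr hΨ hMΨ hcoh

end Frame

/-! ## §5 (v1.1). The final remark about the constant in (3.54) (p. 280): `∂/∂t_□` at `t_□ = 0` yields the factor `O(1)α₂⁻¹ε₁` -/

section Constant

open Literature.MathematicalPhysics.QuantumFieldTheory.Balaban1983to89.B12CauchyRemainder354 (ineq317_printed)

variable {F : Type*} [NormedAddCommGroup F] [NormedSpace ℂ F]

/-- **The mechanism of the final remark** («the mechanism for it is provided by the differentiation with respect to t_□, at t_□ = 0.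
This differentiation yields a factor O(1)α₂⁻¹ε₁»): if the term, as a function `Φ` of `t_□`, is analytic on `|t_□| < R` and bounded by the
(3.54)-constant `C` on the Cauchy circle `|t_□| = r < R` of (3.15) — radius fixed by `r·m = α₂/3` with `m ≤ 2s` the (3.9)-type bound of the
norms in (3.15) — and the size `s` of the `t_□`-direction field is `≤ K·ε₁`, then `‖(d/dt_□)Φ(0)‖ ≤ C·(6Kα₂⁻¹)·ε₁`
(Cauchy: r20's `ineq317_printed`, then `s ≤ Kε₁`). [cite: Balaban1987RG1, p.280 after (3.54); (3.15)/(3.17) p.273] -/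
theorem deriv_tbox_le_factor {Φ : ℂ → F} {r R C m α₂ s K ε₁ : ℝ} (hr : 0 < r) (hrR : r < R)
    (hΦ : DifferentiableOn ℂ Φ (ball 0 R)) (hC : ∀ t ∈ sphere (0 : ℂ) r, ‖Φ t‖ ≤ C) (hC0 : 0 ≤ C)
    (hm : 0 < m) (hα₂ : 0 < α₂) (hrad : r * m = α₂ / 3) (h39 : m ≤ 2 * s) (hs : s ≤ K * ε₁) :
    ‖deriv Φ 0‖ ≤ C * (6 * K * α₂⁻¹) * ε₁ := by
  have h := ineq317_printed hr hrR hΦ hC hC0 hm hα₂ hrad h39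
  refine h.trans ?_
  have h6 : 0 ≤ 6 * α₂⁻¹ := by positivity
  calc C * (6 * α₂⁻¹ * s) ≤ C * (6 * α₂⁻¹ * (K * ε₁)) :=
        mul_le_mul_of_nonneg_left (mul_le_mul_of_nonneg_left hs h6) hC0
    _ = C * (6 * K * α₂⁻¹) * ε₁ := by ring

/-- **«Taking ε₁ sufficiently small we can get the required constant»**: with the (3.54)/(3.35)-constant written `C = C₀·X` (`C₀` «much
bigger than E₀» in place of the inductive constant, `X ≥ 0` the shape factor, e.g. `exp(−κd_j(X))·(O(1)L^jη)⁵`) and `ε₁ ≤ E₀α₂/(6KC₀)`,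
the `t_□`-derivative at `t_□ = 0` obeys the bound with the constant `E₀` of the inductive assumption (1.18): `‖(d/dt_□)Φ(0)‖ ≤ E₀·X`.
[cite: Balaban1987RG1, p.280 after (3.54); (1.18) p.263] -/
theorem deriv_tbox_le_of_eps_small {Φ : ℂ → F} {r R C₀ X m α₂ s K ε₁ E₀ : ℝ} (hr : 0 < r) (hrR : r < R)
    (hΦ : DifferentiableOn ℂ Φ (ball 0 R)) (hC : ∀ t ∈ sphere (0 : ℂ) r, ‖Φ t‖ ≤ C₀ * X) (hC₀ : 0 < C₀) (hX : 0 ≤ X)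
    (hm : 0 < m) (hα₂ : 0 < α₂) (hrad : r * m = α₂ / 3) (h39 : m ≤ 2 * s) (hK : 0 < K) (hs : s ≤ K * ε₁)
    (hε₁ : ε₁ ≤ E₀ * α₂ / (6 * K * C₀)) :
    ‖deriv Φ 0‖ ≤ E₀ * X := by
  have h := deriv_tbox_le_factor hr hrR hΦ hC (by positivity) hm hα₂ hrad h39 hs
  refine h.trans ?_
  have hc : 0 ≤ C₀ * X * (6 * K * α₂⁻¹) := by positivity
  calc C₀ * X * (6 * K * α₂⁻¹) * ε₁ ≤ C₀ * X * (6 * K * α₂⁻¹) * (E₀ * α₂ / (6 * K * C₀)) :=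
        mul_le_mul_of_nonneg_left hε₁ hc
    _ = E₀ * X := by field_simp

end Constant

end Literature.MathematicalPhysics.QuantumFieldTheory.Balaban1983to89.B12Remainder354Localized
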